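import Summits.ABC.IUTFork.Repair.RHQ3LTailUniformRefutation
import Literature.IUT.HodgeTheaters.ThetaGeometryInhabited
import Literature.NumberTheory.EllipticCurves.AnticyclotomicCompactSelmer
import HarnessLib

/-!
# D-0079 RESCUE sub-cell R-H, ROUND 2 Q3 — the Galois-GUARDED uniform reading `UniformLTailSigma8` REFUTED UNCONDITIONALLY:
# the `l`-division field `F‡(λ)(E_λ[l])` of the witness datum is Galois over `ℚ` (seat abc-iut-rh2-q3-typ-1 g3)

PROOF-ONLY file (D-0012; 0 definitions, 0 `Prop` facts, no instance, no notation). Closes the last open item of this lineage's Q3 charge: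
g2's `RH.Q3LTailSigma8.not_uniformLTailSigma8_of_heavyGaloisData` (p481222) refuted the Galois-guarded uniform l-tail reading
`UniformLTailSigma8` (= «ONE `l₀` for all curves and all Def-3.1 data with `K/ℚ` Galois») only MODULO the existence input `HeavyGaloisData`;
the unguarded reading was refuted unconditionally in `RHQ3LTailUniformRefutation` (p489180). HERE: **`not_uniformLTailSigma8 : ¬ UniformLTailSigma8`**
with NO hypothesis (proved directly at the witness datum; the packaged input `HeavyGaloisData` is thereby bypassed, not separately derived).
The one new ingredient is classical Galois theory:

* §1 **`K(E[n])/ℚ` is Galois for a curve over `ℚ` base-changed to a number field `K` normal over `ℚ`**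
  (`isGalois_rat_divisionField_baseChange`): for `φ ∈ Aut(K̄/ℚ)` and `x ∈ K(E[n])`, `φ x ∈ K(E[n])` — the conjugate `φ⁻¹ τ φ` of any
  `τ ∈ Gal(K̄/K)` is `K`-linear (`φ` preserves `K`, Mathlib `AlgEquiv.restrictNormal_commutes`) and fixes `E[n](K̄)` when `τ` does (`φ` acts on
  `E(K̄)` by the `ℚ`-rational base change of points, Mathlib `WeierstrassCurve.Affine.Point.map`, and preserves `n`-torsion; the tree's
  `smul_geomPoints_eq_map_restrictScalars`, `WeierstrassCurve.mem_divisionField_iff`), so `K(E[n])` is stable under `Aut(K̄/ℚ)` and normal over `ℚ`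
  (Mathlib `IntermediateField.normal_iff_forall_map_le'`, `K̄` being an algebraic closure of `ℚ`) — Silverman AEC VIII.§1 over the base `ℚ`;
* §2 at a rational point `λ ∈ U_P(ℚ)` with `AdmitsCore`, (P2), (P5), (P6): a genuine Θ-volume datum `T` at `(ratPoint λ, l)` with `T.K = F‡(E_λ ⊗ F‡[l])`
  GALOIS OVER `ℚ` (`exists_thetaVolumeDatumAt_isGalois` — the construction of abc-iut-L5-t7's `Cor22.thetaDataExistsAt_of_condP6_thetaClosure` /
  c312-8's `ThetaPartII.stub_thetaData` made explicit, `F‡` Galois over `F_tpd = ℚ` by `Cor22.isGalois_thetaClosureField`, `E_λ ⊗ F‡` the base change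
  of `E_λ/ℚ` by `Cor22.thetaCurve_thetaClosureField_eq`);
* §3 the assembly with the row-8 witness of `RHQ3LTailUniformRefutation` (prime `l ≡ 3 (mod 4)`, `l > max(l₀,160)`; prime `r ∈ (30l, 60l]`;
  `λ_r = r⁸/(r⁸+1)`; `UniformWitness.condP6`, `not_inSigma8_of_datum`).
READING (numbers, no side): «Q3: YES PER DATUM, NOT UNIFORMLY» now holds with both halves theorems in EVERY typed form of the lineage
(`lTailSigma8_holds` / `not_exists_uniform_l0_inSigma8` / `not_uniformLTailSigma8`). Nothing here asserts abc or takes a side on [IUTchIII] Cor. 3.12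
or on any author; `InSigma8` is row 8's hypothesis vocabulary; the Θ-data are the tree's interface inhabitants as in every R-W refutation of record;
refuted-as-typed ≠ refuted-in-print; typed ≠ proved.
[cite: Mochizuki2012, IUTchI Def. 3.1 (b)(c) pp. 61–62; IUTchIV Thm. 1.10 p. 22 (the field `F`), Cor. 2.2 (ii) proof (P2)(P5)(P6)(P7) pp. 45–46]
[cite: SilvermanAEC2009, VIII.§1 (the action of `G_{K̄/K}` on `E[m]`, `K(E[m])/K` Galois)] [claim: Mochizuki2012, status: disputed] for every IUT locution.
-/

noncomputable section

open Set Function NumberField IsDedekindDomain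

namespace Summit.ABC.IUTFork.Repair.RH.Q3LTailSigma8

open Literature.IUT.LogThetaLattice Literature.IUT.LogVolume Literature.IUT.HodgeTheaters
open Literature.IUT.LogVolume.ThetaData Literature.IUT.LogVolume.Cor22
open Summit.ABC.IUTFork.Thm311 Summit.ABC.IUTFork.Thm311.Real Summit.ABC.IUTFork.Cor312Prov
open Literature.NumberTheory.NumberFields Literature.NumberTheory.DiophantineGeometry
  Literature.NumberTheory.DiophantineGeometry.GenEll Literature.NumberTheory.DiophantineGeometry.UniformABCConjecture
  Rat.HeightOneSpectrum Summit.ABC.ABC.Theorems Summit.ABC.IUTFork.Conditional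

namespace UniformWitness

/-! ## §1. The division field of a curve over `ℚ`, base-changed to a normal number field, is Galois over `ℚ` -/

section DivisionFieldRat

open scoped Classical
open Literature.NumberTheory.EllipticCurves WeierstrassCurve IntermediateField

variable (W : WeierstrassCurve ℚ) (K : Type) [Field K] [NumberField K] [Normal ℚ K] (n : ℕ)

/-- **`Aut(K̄/ℚ)` preserves `K(E[n])`** for `E = W ⊗ K`, `W/ℚ`, `K/ℚ` normal: if `x ∈ K(E[n])` and `φ ∈ Aut(K̄/ℚ)` then `φ x ∈ K(E[n])`
(the conjugate `φ⁻¹τφ` of `τ ∈ Gal(K̄/K)` is `K`-linear and fixes `E[n](K̄)` whenever `τ` does). [cite: SilvermanAEC2009, VIII.§1] -/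
theorem divisionField_baseChange_map_mem (φ : AlgebraicClosure K ≃ₐ[ℚ] AlgebraicClosure K) {x : AlgebraicClosure K}
    (hx : x ∈ (W.baseChange K).divisionField n) : φ x ∈ (W.baseChange K).divisionField n := by
  rw [WeierstrassCurve.mem_divisionField_iff] at hx ⊢
  intro τ hτ
  -- the `K`-automorphism `τ₀` underlying `τ`, and the conjugate `ψ = φ⁻¹ τ₀ φ` as a `ℚ`-automorphism
  set τ₀ : AlgebraicClosure K ≃ₐ[K] AlgebraicClosure K := Field.absoluteGaloisGroup.toAlgEquiv K τ with hτ₀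
  set ψ : AlgebraicClosure K ≃ₐ[ℚ] AlgebraicClosure K := (φ.trans (τ₀.restrictScalars ℚ)).trans φ.symm with hψdef
  have hψ : ∀ y, ψ y = φ.symm (τ₀ (φ y)) := fun y => rfl
  -- `ψ` is `K`-linear: `φ` preserves `K ⊆ K̄` (`K/ℚ` normal)
  have hcomm : ∀ k : K, ψ (algebraMap K (AlgebraicClosure K) k) = algebraMap K (AlgebraicClosure K) k := by
    intro k
    rw [hψ, ← AlgEquiv.restrictNormal_commutes φ K k, AlgEquiv.commutes τ₀, AlgEquiv.restrictNormal_commutes,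
      AlgEquiv.symm_apply_apply]
  set ρ₀ : AlgebraicClosure K ≃ₐ[K] AlgebraicClosure K := { ψ with commutes' := hcomm } with hρ₀
  have hρ₀ψ : ∀ y, ρ₀ y = ψ y := fun y => rfl
  set ρ : Field.absoluteGaloisGroup K := (Field.absoluteGaloisGroup.toAlgEquiv K).symm ρ₀ with hρ
  -- `ρ` fixes the `n`-torsion
  have hρT : ∀ T : geomTorsion (W.baseChange K) n, ρ • T = T := by
    intro T
    apply Subtype.ext
    rw [AddSubgroup.torsionBy.coe_smul]
    set P : geomPoints (W.baseChange K) := (T : geomPoints (W.baseChange K)) with hPdef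
    have hP : (n : ℤ) • P = 0 := (mem_geomTorsion_iff _ _ _).1 T.2
    -- `ρ • P = φ⁻¹ (τ₀ (φ P))` on points
    rw [smul_geomPoints_eq_map_restrictScalars]
    have hrs : (((Field.absoluteGaloisGroup.toAlgEquiv K ρ : AlgebraicClosure K ≃ₐ[K] AlgebraicClosure K) :
        AlgebraicClosure K →ₐ[K] AlgebraicClosure K).restrictScalars ℚ) =
        ((φ.symm : AlgebraicClosure K ≃ₐ[ℚ] AlgebraicClosure K) : AlgebraicClosure K →ₐ[ℚ] AlgebraicClosure K).comp
          ((((τ₀ : AlgebraicClosure K ≃ₐ[K] AlgebraicClosure K) : AlgebraicClosure K →ₐ[K] AlgebraicClosure K).restrictScalars ℚ).comp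
            ((φ : AlgebraicClosure K ≃ₐ[ℚ] AlgebraicClosure K) : AlgebraicClosure K →ₐ[ℚ] AlgebraicClosure K)) := by
      apply AlgHom.ext
      intro y
      change (Field.absoluteGaloisGroup.toAlgEquiv K ρ) y = φ.symm (τ₀ (φ y))
      rw [hρ, MulEquiv.apply_symm_apply, hρ₀ψ, hψ]
    rw [hrs, ← Affine.Point.map_map, ← Affine.Point.map_map]
    -- `Q := φ P` is again `n`-torsion, so `τ` fixes it
    set Q := Affine.Point.map (W' := W) ((φ : AlgebraicClosure K ≃ₐ[ℚ] AlgebraicClosure K) :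
      AlgebraicClosure K →ₐ[ℚ] AlgebraicClosure K) P with hQdef
    have hQ : (n : ℤ) • Q = 0 := by
      rw [hQdef, ← map_zsmul]
      exact (congrArg _ hP).trans (map_zero _)
    have hτQ : τ • (show geomPoints (W.baseChange K) from Q) = Q := by
      have := congrArg Subtype.val (hτ ⟨Q, (mem_geomTorsion_iff _ _ _).2 hQ⟩)
      rwa [AddSubgroup.torsionBy.coe_smul] at this
    rw [smul_geomPoints_eq_map_restrictScalars] at hτQ
    change Affine.Point.map (W' := W) ((φ.symm : AlgebraicClosure K ≃ₐ[ℚ] AlgebraicClosure K) : AlgebraicClosure K →ₐ[ℚ] AlgebraicClosure K)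
      (Affine.Point.map (W' := W) (((τ₀ : AlgebraicClosure K ≃ₐ[K] AlgebraicClosure K) :
        AlgebraicClosure K →ₐ[K] AlgebraicClosure K).restrictScalars ℚ) Q) = P
    rw [hτ₀, hτQ, hQdef, Affine.Point.map_map]
    have hid : ((φ.symm : AlgebraicClosure K ≃ₐ[ℚ] AlgebraicClosure K) : AlgebraicClosure K →ₐ[ℚ] AlgebraicClosure K).comp
        ((φ : AlgebraicClosure K ≃ₐ[ℚ] AlgebraicClosure K) : AlgebraicClosure K →ₐ[ℚ] AlgebraicClosure K) = AlgHom.id ℚ _ := by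
      ext y; exact φ.symm_apply_apply y
    rw [hid]
    cases P <;> rfl
  -- hence `ρ • x = x`, i.e. `φ⁻¹ (τ (φ x)) = x`
  have hρx : ρ • x = x := hx ρ hρT
  have h1 : ρ • x = φ.symm (τ₀ (φ x)) := by
    change (Field.absoluteGaloisGroup.toAlgEquiv K ρ) x = _
    rw [hρ, MulEquiv.apply_symm_apply, hρ₀ψ, hψ]
  rw [h1] at hρx
  calc τ • φ x = τ₀ (φ x) := rfl
    _ = φ (φ.symm (τ₀ (φ x))) := (φ.apply_symm_apply _).symm
    _ = φ x := by rw [hρx]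

/-- **`K(E[n])/ℚ` is GALOIS** for `E = W ⊗ K` elliptic, `W/ℚ`, `K/ℚ` a normal number field, `n ≠ 0`: `K̄` is an algebraic closure of `ℚ`, `K(E[n])`
is stable under `Aut(K̄/ℚ)` (previous theorem), hence normal over `ℚ` (Mathlib `IntermediateField.normal_iff_forall_map_le'`), and separable
(characteristic `0`). Stated for the TYPE `K(E[n])` with its canonical `ℚ`-algebra structure (transport along the identity by
`IsGalois.of_algEquiv`; `ℚ →+* K(E[n])` is unique). [cite: SilvermanAEC2009, VIII.§1] -/
theorem isGalois_rat_divisionField_baseChange [(W.baseChange K).IsElliptic] [NeZero n] :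
    IsGalois ℚ ((W.baseChange K).divisionField n) := by
  haveI : IsAlgClosure ℚ (AlgebraicClosure K) := IsAlgClosure.ofAlgebraic ℚ K (AlgebraicClosure K)
  haveI : Normal ℚ (AlgebraicClosure K) := IsAlgClosure.normal ℚ (AlgebraicClosure K)
  set L' : IntermediateField ℚ (AlgebraicClosure K) := ((W.baseChange K).divisionField n).restrictScalars ℚ with hL'
  -- over the intermediate-field `ℚ`-algebra structure of `L'`
  letI instA : Algebra ℚ L' := L'.algebra'
  have hN : Normal ℚ L' := by
    rw [IntermediateField.normal_iff_forall_map_le']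
    intro σ x hx
    rw [IntermediateField.mem_map] at hx
    obtain ⟨y, hy, rfl⟩ := hx
    exact divisionField_baseChange_map_mem W K n σ hy
  haveI : IsGalois ℚ L' := ⟨⟩
  -- transport to the canonical `ℚ`-algebra structure on the same field
  refine IsGalois.of_algEquiv (E := L') (AlgEquiv.ofRingEquiv (f := (RingEquiv.refl L' : L' ≃+* ((W.baseChange K).divisionField n))) ?_)
  intro q
  exact RingHom.congr_fun (Subsingleton.elim
    ((RingEquiv.refl L' : L' ≃+* ((W.baseChange K).divisionField n)).toRingHom.comp (algebraMap ℚ L'))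
    (algebraMap ℚ ((W.baseChange K).divisionField n))) q

/-- The same for ANY `ℚ`-algebra structure on `K` (they are all equal): `K(E[n])/ℚ` is Galois, `E = W ⊗ K` taken along the given `ℚ → K`.
[cite: SilvermanAEC2009, VIII.§1] -/
theorem isGalois_rat_divisionField_baseChange' (W : WeierstrassCurve ℚ) (K : Type) [Field K] [NumberField K] [instA : Algebra ℚ K]
    [Normal ℚ K] (n : ℕ) [(W.baseChange K).IsElliptic] [NeZero n] : IsGalois ℚ ((W.baseChange K).divisionField n) := by
  obtain rfl : instA = DivisionRing.toRatAlgebra := Subsingleton.elim _ _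
  exact isGalois_rat_divisionField_baseChange W K n

/-- Transport of `IsGalois ℚ` along a ring isomorphism (the `ℚ`-algebra structures are automatic: `ℚ →+* B` is unique). [folklore] -/
theorem isGalois_rat_of_ringEquiv {A B : Type} [Field A] [Field B] [Algebra ℚ A] [Algebra ℚ B] (e : A ≃+* B) [IsGalois ℚ A] :
    IsGalois ℚ B :=
  IsGalois.of_algEquiv (AlgEquiv.ofRingEquiv (f := e)
    (fun q => RingHom.congr_fun (Subsingleton.elim (e.toRingHom.comp (algebraMap ℚ A)) (algebraMap ℚ B)) q))

end DivisionFieldRat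

/-! ## §2. A genuine Θ-volume datum at a rational point whose `K = F‡(E[l])` is Galois over `ℚ` -/

section Datum

/-- **At an admissible rational point the genuine Θ-volume datum of record has `K/ℚ` GALOIS.** For `λ ∈ U_P(ℚ)`, a prime `l ≥ 5`, `AdmitsCore`,
(P2), (P5), (P6): there is a genuine Θ-volume datum `T` at `(ratPoint λ, l)` with `IsGalois ℚ T.K` — the inhabitant of abc-iut-L5-t7 / c312-8
(`Cor22.thetaDataExistsAt_of_condP6_thetaClosure`, `ThetaPartII.stub_thetaData`: `F := F‡(λ) = ℚ(√−1, √λ, √(λ−1), E_λ[15])`, `E := E_λ ⊗ F‡`,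
`K := F‡(E[l])`, interface inhabitants of Def. 3.1 (d)(e)(f)) made explicit, `F‡/ℚ` being Galois (`Cor22.isGalois_thetaClosureField`) and
`E_λ ⊗ F‡` the base change of `E_λ/ℚ` (`Cor22.thetaCurve_thetaClosureField_eq`), so that §1 applies.
[cite: Mochizuki2012, IUTchIV Thm. 1.10 p. 22, Cor. 2.2 (ii) proof (P7) p. 46] [claim: Mochizuki2012, status: disputed] -/
theorem exists_thetaVolumeDatumAt_isGalois {q : ℚ} (hP : ratPoint q ∈ UP) {l : ℕ} (hl : l.Prime) (h5 : 5 ≤ l)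
    (hcore : AdmitsCore (ratPoint q)) (hP2 : CondP2 (ratPoint q) l) (hP5 : CondP5 (ratPoint q) l) (h6 : CondP6 (ratPoint q) l) :
    ∃ T : ThetaVolumeDatumAt (ratPoint q) l, (letI := T.instFieldK; letI := T.instNumberFieldK; IsGalois ℚ T.K) := by
  set P := ratPoint q with hPdef
  haveI : Fact P.InU := ⟨hP.1⟩
  haveI : (thetaCurve P (thetaClosureField P)).IsElliptic := thetaCurve_isElliptic hP.1 _
  haveI : NeZero l := ⟨hl.ne_zero⟩
  haveI : IsGalois (thetaClosureField P) (AlgebraicClosure (thetaClosureField P)) := {}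
  have h7 : 7 ≤ l := Cor22.seven_le_of_condP6 hP.1 hl h5 h6
  have h6cop : l.Coprime 6 := by
    rw [show (6 : ℕ) = 2 * 3 by norm_num]
    exact Nat.Coprime.mul_right ((Nat.coprime_primes hl Nat.prime_two).2 (by omega))
      ((Nat.coprime_primes hl Nat.prime_three).2 (by omega))
  obtain ⟨geom⟩ := ThetaGeometryModel.nonempty_thetaGeometry_galois (thetaClosureField P)
    (TorsionField (thetaCurve P (thetaClosureField P)) l) (AlgebraicClosure (thetaClosureField P)) h5 h6cop
  obtain ⟨D, hD, hP5c⟩ := exists_initialThetaData_thetaClosure P hP hl h7 hcore hP2 hP5 h6 (BadPlacePredicates.trivial _) geom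
    (fun w _ => (BadPlacePredicates.trivial_holds _ w).1) (fun w _ => (BadPlacePredicates.trivial_holds _ w).2)
  obtain ⟨I, hI⟩ := ThetaData.exists_isVolumeInputOf D
  have hj : (thetaCurve P (thetaClosureField P)).j = algebraMap P.F (thetaClosureField P) (jInv P.x) := by
    have := thetaCurve_j (F := thetaClosureField P) hP.1
    convert this using 2
  refine ⟨{ F := thetaClosureField P
            K := TorsionField (thetaCurve P (thetaClosureField P)) l
            Fbar := AlgebraicClosure (thetaClosureField P)
            E := thetaCurve P (thetaClosureField P)
            j_eq := hj
            torsion_thirty_rational := torsion_thirty_rational_thetaClosure P hP.1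
            isSubThetaField := isSubThetaField_thetaClosureField P hP.1
            Pb := BadPlacePredicates.trivial _
            D := D
            I := I
            isP5Choice := hP5c
            isVolumeInputOf := hI }, ?_⟩
  -- `K = F‡(E[l])` with `E = E_λ ⊗ F‡`, `E_λ/ℚ`, `F‡/ℚ` normal: §1
  change IsGalois ℚ (TorsionField (thetaCurve P (thetaClosureField P)) l)
  letI instIF : Algebra ℚ (thetaClosureField P) := (thetaClosureField P).algebra
  haveI hN : Normal ℚ (thetaClosureField P) := IsGalois.to_normal (F := P.F) (E := thetaClosureField P)
  haveI : P.legendreCurve.IsElliptic := P.legendreCurve_isElliptic_iff.2 hP.1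
  haveI hE' : (WeierstrassCurve.baseChange (P.legendreCurve : WeierstrassCurve ℚ) (thetaClosureField P)).IsElliptic := by
    have hE : thetaCurve P (thetaClosureField P) = (P.legendreCurve : WeierstrassCurve ℚ).baseChange (thetaClosureField P) :=
      thetaCurve_thetaClosureField_eq P
    rw [← hE]; infer_instance
  have key := @isGalois_rat_divisionField_baseChange' (P.legendreCurve : WeierstrassCurve ℚ) (thetaClosureField P) _ _ instIF hN l hE' _
  have hE : thetaCurve P (thetaClosureField P) = (P.legendreCurve : WeierstrassCurve ℚ).baseChange (thetaClosureField P) :=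
    thetaCurve_thetaClosureField_eq P
  rw [hE]
  exact @isGalois_rat_of_ringEquiv _ _ _ _ (_) _ (RingEquiv.refl _) key

end Datum

/-! ## §3. `¬ UniformLTailSigma8`, unconditionally -/

/-- **THE GALOIS-GUARDED UNIFORM READING IS FALSE**: `¬ UniformLTailSigma8` (g2's target, p481222), now with NO hypothesis — at a given `l₀`: a prime
`l ≡ 3 (mod 4)`, `l > max(l₀,160)` (Dirichlet), a prime `r ∈ (30l, 60l]` (Bertrand), the point `λ_r = r⁸/(r⁸+1)` (admissible with (P2), (P5), (P6):
`RHQ3LTailUniformWitness`, `UniformWitness.condP6`), the genuine Θ-volume datum of §2 (its `K = F‡(λ_r)(E[l])` Galois over `ℚ`), outside Σ₈ by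
`not_inSigma8_of_datum` (p489180). [cite: Mochizuki2012, IUTchI Def. 3.1 (b)(c) pp. 61–62; IUTchIV Prop. 1.2 (i)(ii) p. 10, Cor. 2.2 (ii) proof
(P2)(P5)(P6)(P7) pp. 45–46] [cite: SilvermanAEC2009, VIII.§1] [claim: Mochizuki2012, status: disputed] -/
theorem not_uniformLTailSigma8 : ¬ UniformLTailSigma8 := by
  rintro ⟨l₀, h⟩
  obtain ⟨l, hlgt, hl, hmod⟩ := Nat.forall_exists_prime_gt_and_modEq (max l₀ 160) (q := 4) (a := 3) (by norm_num) (by norm_num)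
  have hl0 : l₀ ≤ l := le_trans (le_max_left _ _) hlgt.le
  have hl160 : 160 ≤ l := le_trans (le_max_right _ _) hlgt.le
  have hmod' : l % 4 = 3 := hmod
  obtain ⟨r, hr, h30, h60⟩ := Nat.exists_prime_lt_and_le_two_mul (30 * l) (by omega)
  have hr2 : r ≠ 2 := by omega
  have hr5 : r ≠ 5 := by omega
  have hrl : r ≠ l := by omega
  have h3l : r ^ 8 + 1 < 3 ^ l := pow_eight_succ_lt_three_pow hl160 (by omega)
  obtain ⟨T, hGal⟩ := exists_thetaVolumeDatumAt_isGalois (mem_UP r hr.pos) hl (by omega) (admitsCore r hr (by omega))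
    (condP2 r hr hr2 hl (by omega) h3l) (condP5 r hr hr2 hl hrl) (condP6 r hr hr2 hr5 hl (by omega) hmod' hrl)
  letI := T.instFieldF; letI := T.instNumberFieldF; letI := T.instAlgebraF; letI := T.instFieldK
  letI := T.instNumberFieldK; letI := T.instAlgebraK; letI := T.instFieldFbar; letI := T.instAlgebraFbar
  letI := T.instAlgebraKFbar; letI := T.instIsElliptic
  exact not_inSigma8_of_datum T hl (by omega) hr h30 (h l hl0 T.F T.E T.K T.Fbar T.Pb T.D hGal)

end UniformWitness

end Summit.ABC.IUTFork.Repair.RH.Q3LTailSigma8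

end
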